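import Literature.LinearAlgebra.Matrix.LatimerMacDuffeeSquarefree
import Literature.NumberTheory.ComplexMultiplication.FiniteQAlgebraLatticeExactIdealClassesFinite
import HarnessLib

/-!
# Hertling–Larabi 2026b REMARKS 6.3 (v): the ORDER of a `GLₙ(ℤ)`-conjugacy class of regular integer matrices, and
# the partition of `S_{1,f}` into the strata `{[L]_ε | 𝒪(L) = Λ}`, each FINITE (HL26b Thm. 5.3 = HL 2026 Thm. 6.5),
# infinitely many of them iff `f` has a multiple root

[topic LinearAlgebra/Matrix] Sequel to `LatimerMacDuffeeRegularMatrices` (HL26b Thm. 6.2 = the Latimer–MacDuffee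
correspondence `S_{1,g} ≃ S_{2,g}` for an arbitrary monic `g`) and `LatimerMacDuffeeSquarefree` (Rem. 6.3 (iv);
its docstring: «NOT here: Rem. 6.3 (v) (the partition of `S_{1,f}` by the order `𝒪(L) ⊃ Λ_f`)») — supplied here,
using HL 2026 Thm. 6.5 for every finite-dimensional commutative `ℚ`-algebra
(`FiniteQAlgebraLatticeExactIdealClassesFinite.finite_quot_div_self_eq`, the tree's general-`A` series).
Lane `lit-hodgefound` (Track 2 foundations library), seat p19 generation 38, row g38-#2.  THEOREMS ONLY: no
definition, no instance, no notation, no named fact (D-0026, net Literature debt `0`), no `sorry`.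

## Source, VERBATIM

C. Hertling, K. Larabi, *Conjugacy classes of regular integer matrices*, arXiv:2602.15748 (2026)
[HertlingLarabi2026b], held `paper:arxiv-2602.15748`, §6 Remarks 6.3 (chunk p0013):
«(iii) The unit element `[Λ_f]` in `S_{2,f}` corresponds to the `GL_n(ℤ)`-conjugacy class `[M_f]_ℤ` in `S_{1,f}`.
(iv) The following conditions are equivalent: (α) `A_f` is separable. (β) `f` does not have multiple roots in `ℂ`.
[…] (ε) `S_{1,f}` is finite. […]
(v) In any case, the set `S_{1,f}` splits into the disjoint union
`⊔̇_{Λ ⊃ Λ_f order} {[L]_ε | L ∈ 𝓛(A_f), 𝒪(L) = Λ}` (6.7) of sets which are finite by Theorem 5.3. If the conditions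
in (iv) do not hold, it is a union of infinitely many finite sets. In any case, for `B` with `[B]_ℤ ∈ S_{1,f}` the
order `Λ ⊃ Λ_f` with `Λ = 𝒪(L)` and `[B]_ℤ ∼ [L]_ε` is an interesting invariant of the `GL_n(ℤ)`-conjugacy class
`[B]_ℤ` of `B`.»  Theorem 6.2 and its proof (chunks p0012–p0013): «`S_{1,f} := {[B]_ℤ | B ∈ M_{n×n}(ℤ) is regular
with p_B = f}`, `S_{2,f} := {[L]_ε | L ∈ 𝓛(A_f) with 𝒪(L) ⊃ Λ_f}` […] (ii) From `L` with `[L]_ε ∈ S_{2,f}` to `B`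
with `[B]_ℤ ∈ S_{1,f}`. Choose a `ℤ`-basis `(b_1,...,b_n)` of `L`. Then `t̄(b_1,...,b_n) = (b_1,...,b_n)·B` (6.5) for
a unique matrix `B ∈ M_{n×n}(ℤ)`. Proof: […] Any full lattice `L ∈ 𝓛(A_f)` induces by (6.5) a `GL_n(ℤ)`-conjugacy
class of regular matrices in `M_{n×n}(ℚ)` with characteristic polynomial `f`. It consists of matrices in
`M_{n×n}(ℤ)` if and only if `t̄L ⊂ L`, so if and only if `𝒪(L) ⊃ Λ_f`. […] Then `BC = CB`, so by Lemma 6.1 (c) (iv)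
`C = Σ_{l=0}^{n−1} c_lB^l ∈ ℚ[B]`. The element `c := Σ c_l t̄^l` satisfies `c ∈ A_f^{unit}`, `c𝔅_1 = 𝔅_2`,
`cL_1 = L_2`».  Def./Lemma 6.1 (e) (chunk p0012): «`[B]_ℤ := {C⁻¹BC | C ∈ GL_n(ℤ)}` the `GL_n(ℤ)`-conjugacy
class of `B`.»  Theorem 5.3 of [HertlingLarabi2026b] = [HertlingLarabi2026] Thm. 6.5 (chunk p0015): «For any order
`Λ` in `A`, the set `{[L]_ε | L ∈ 𝓛(A), 𝒪(L) = Λ}` of `ε`-classes of exact `Λ`-ideals is finite.»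

## The order of a conjugacy class, in matrix terms (def-free)

Under Theorem 6.2 a regular integer matrix `B` with `p_B = g` (`minpoly_ℚ B = g`, as in the sequel files) is
represented by a `ℤ`-basis `𝔅` of a full `t̄`-stable lattice `L = ⊕ ℤb_i ⊂ A_g = ℚ[t]/(g)`: `t̄𝔅 = 𝔅·B`.  Then the
matrix of `μ_{p(t̄)}` in `𝔅` is `p(B)` (§2), so `p(t̄)·L ⊆ L ⟺ p(B) ∈ M_{n×n}(ℤ)`, i.e.
**`𝒪(L) = {p(t̄) | p(B) ∈ M_{n×n}(ℤ)}`** (`mk_mem_div_self_iff`).  Accordingly «the order of `[B]_ℤ` is `Λ`» is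
spelled, for `Λ : Submodule ℤ A_g`,
`∀ p : ℚ[X], t̄-class of p ∈ Λ ↔ ∃ C : Matrix (Fin n) (Fin n) ℤ, C = p(B)` (as rational matrices);
this determines `Λ` (`order_unique`), every regular `B` has such a `Λ = 𝒪(L_B)` — a full lattice and an order
containing `Λ_g = ℤ[t̄]` (`exists_order_of_minpoly_eq`) — and conjugate matrices have the same order
(`order_eq_of_conj`, through Thm. 6.2: conjugate matrices ↦ `ε`-equivalent lattices, and `𝒪(cL) = 𝒪(L)`).

## What is proved (`g ∈ ℚ[t]` monic of degree `n`, `A_g = AdjoinRoot g`, `t̄ = AdjoinRoot.root g`; for (v) proper: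
## `g = f̄`, `f ∈ ℤ[t]` monic of degree `n`)

* §1 `equivalence_conj`: `GLₙ(ℤ)`-conjugacy (`PB = B'P`, `P` unimodular) is an equivalence relation (6.1 (e)).
* §2 `toMatrix_mulLeft_aeval` (`[μ_{p(θ)}]_𝔅 = p([μ_θ]_𝔅)`, any `ℚ`-algebra), `toMatrix_mulLeft_aeval_eq`
  (`= p(B)` for a representing basis), `forall_mem_span_map_mem_iff` (an endomorphism preserves `⊕ ℤb_i` iff its
  matrix is integral), **`mk_mem_div_self_iff`** (`p(t̄) ∈ 𝒪(L) ⟺ p(B) ∈ M_{n×n}(ℤ)`).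
* §3 `exists_order_of_minpoly_eq`, `order_unique`, `div_self_eq_of_represents`, `order_eq_of_conj` (the order is
  an invariant of the class).
* §4 **`finite_quot_conj_of_order` — REMARKS 6.3 (v), «sets which are finite by Theorem 5.3»: for every `Λ`, the
  `GLₙ(ℤ)`-classes of regular integer matrices with `p_B = g` and order `Λ` form a FINITE set**, for ANY monic `g`
  (multiple roots allowed): `[B]_ℤ ↦ [L_B]_ε` embeds the stratum into `{[L]_ε | 𝒪(L) = Λ}`, finite by HL 2026
  Thm. 6.5; `exists_order_and_mem_stratum` («`S_{1,f}` splits into the disjoint union» — every class has its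
  stratum, disjointness being `order_unique`).
* §5 **`finite_setOf_order_iff_squarefree` — «If the conditions in (iv) do not hold, it is a union of infinitely
  many finite sets»: the set of orders that occur is finite iff `f` is square-free over `ℚ`** (⟸ Rem. 6.3 (iv):
  `S_{1,f}` finite; ⟹ the strata are finite and cover `S_{1,f}`, which is infinite when `f` has a multiple root,
  `LatimerMacDuffeeSquarefree.finite_quot_conj_iff_squarefree`); `infinite_setOf_order_of_not_squarefree`.
* §6 `mk_mem_adjoin_iff_companion` — Rem. 6.3 (iii)+(v): the order of `[M_f]_ℤ` is `Λ_f = ℤ[t̄]`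
  (`p(t̄) ∈ ℤ[t̄] ⟺ p(M_f) ∈ M_{n×n}(ℤ)`).
NOT here: Rem. 6.3 (i)–(ii) (the monoid structure of `S_{1,f}` and Taussky's composition of classes), Thm. 6.4
(non-regular matrices).

## References

* [HertlingLarabi2026b] C. Hertling, K. Larabi, *Conjugacy classes of regular integer matrices*, arXiv:2602.15748
  (2026), §6 Def./Lemma 6.1 (e), Thm. 6.2 (LMD33) and proof, Rem. 6.3 (iii)–(v) (chunks p0012–p0013); Thm. 5.3
  (= [HertlingLarabi2026] Thm. 6.5). [cite: HertlingLarabi2026b, §6 Rem. 6.3 (v), chunk p0013]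
* [HertlingLarabi2026] C. Hertling, K. Larabi, *Semigroups from full lattices in commutative ℚ-algebras*,
  arXiv:2602.14973 (2026), §6 Thm. 6.5 (chunk p0015) — the tree's
  `FiniteQAlgebraLatticeExactIdealClassesFinite.finite_quot_div_self_eq`. [cite: HertlingLarabi2026, §6 Thm. 6.5, chunk p0015]
* [LatimerMacduffee1933] C. G. Latimer, C. C. MacDuffee, *A correspondence between classes of ideals and classes of
  matrices*, Ann. of Math. 34 (1933) 313–316 (the correspondence, as cited by [HertlingLarabi2026b] Thm. 6.2).
  [cite: LatimerMacduffee1933, as cited by HertlingLarabi2026b Thm. 6.2]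
-/

noncomputable section

open scoped Classical Pointwise
open Polynomial Module Submodule Matrix

namespace Literature.LinearAlgebra.Matrix.LatimerMacDuffeeOrderStrata

open Literature.NumberTheory.Automorphic (IsFullLattice)
open Literature.LinearAlgebra.Matrix.LatimerMacDuffeeRegular
open Literature.LinearAlgebra.Matrix.LatimerMacDuffeeSquarefree (equivalence_exists_units_smul
  infinite_quot_conj_of_not_squarefree finite_quot_conj_iff_squarefree)
open Literature.NumberTheory.ComplexMultiplication.FiniteQAlgebraLattice (isFullLattice_div
  finite_quot_div_self_eq div_self_units_smul)

variable {n : ℕ} {g : ℚ[X]}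

/-! ## §1 `GLₙ(ℤ)`-conjugacy is an equivalence relation -/

/-- **`GLₙ(ℤ)`-conjugacy (`PB = B'P`, `P` unimodular) is an equivalence relation** on any set of integer matrices
(HL Def./Lemma 6.1 (e): «`[B]_ℤ := {C⁻¹BC | C ∈ GL_n(ℤ)}` the `GL_n(ℤ)`-conjugacy class of `B`»).
[cite: HertlingLarabi2026b, §6 Def./Lemma 6.1 (e), chunk p0012] -/
theorem equivalence_conj (q : Matrix (Fin n) (Fin n) ℤ → Prop) :
    Equivalence fun B B' : {B : Matrix (Fin n) (Fin n) ℤ // q B} =>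
      ∃ P : Matrix (Fin n) (Fin n) ℤ, IsUnit P.det ∧ P * B.1 = B'.1 * P where
  refl B := ⟨1, by simp, by rw [one_mul, mul_one]⟩
  symm := by
    rintro B B' ⟨P, hP, hPB⟩
    refine ⟨P⁻¹, Matrix.isUnit_nonsing_inv_det P hP, ?_⟩
    calc P⁻¹ * B'.1 = P⁻¹ * B'.1 * (P * P⁻¹) := by rw [Matrix.mul_nonsing_inv P hP, mul_one]
      _ = P⁻¹ * (B'.1 * P) * P⁻¹ := by simp only [mul_assoc]
      _ = P⁻¹ * (P * B.1) * P⁻¹ := by rw [hPB]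
      _ = B.1 * P⁻¹ := by rw [← mul_assoc, Matrix.nonsing_inv_mul P hP, one_mul]
  trans := by
    rintro B B' B'' ⟨P, hP, hPB⟩ ⟨P', hP', hP'B⟩
    refine ⟨P' * P, by rw [Matrix.det_mul]; exact hP'.mul hP, ?_⟩
    rw [mul_assoc, hPB, ← mul_assoc, hP'B, mul_assoc]

/-! ## §2 The matrix of `μ_{p(t̄)}` in a representing basis is `p(B)`; stability ⟺ integrality -/

section Represents

variable {A : Type*} [Ring A] [Algebra ℚ A]

/-- In ANY basis `𝔅`, the matrix of the multiplication by `p(θ)` is `p` evaluated at the matrix of the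
multiplication by `θ`: `[μ_{p(θ)}]_𝔅 = p([μ_θ]_𝔅)` (`a ↦ [μ_a]_𝔅` is a `ℚ`-algebra homomorphism).
[cite: HertlingLarabi2026b, §6 Thm. 6.2 (proof: «`C = Σ c_l B^l ∈ ℚ[B]` […] `c := Σ c_l t̄^l`»), chunk p0013] -/
theorem toMatrix_mulLeft_aeval (b : Basis (Fin n) ℚ A) (θ : A) (p : ℚ[X]) :
    LinearMap.toMatrix b b (LinearMap.mulLeft ℚ (aeval θ p)) =
      aeval (LinearMap.toMatrix b b (LinearMap.mulLeft ℚ θ)) p := by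
  have e : ∀ a : A, LinearMap.mulLeft ℚ a = Algebra.lmul ℚ A a := fun a =>
    LinearMap.ext fun x => by rw [LinearMap.mulLeft_apply, Algebra.coe_lmul_eq_mul, LinearMap.mul_apply']
  let F : A →ₐ[ℚ] Matrix (Fin n) (Fin n) ℚ :=
    ((LinearMap.toMatrixAlgEquiv b : (A →ₗ[ℚ] A) ≃ₐ[ℚ] Matrix (Fin n) (Fin n) ℚ) :
      (A →ₗ[ℚ] A) →ₐ[ℚ] Matrix (Fin n) (Fin n) ℚ).comp (Algebra.lmul ℚ A)
  have hF : ∀ a : A, F a = LinearMap.toMatrix b b (LinearMap.mulLeft ℚ a) := fun a => by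
    rw [e]
    rfl
  rw [← hF, ← hF, Polynomial.aeval_algHom_apply]

/-- With `θ𝔅 = 𝔅·B` (`𝔅` represents the integer matrix `B`): **the matrix of `μ_{p(θ)}` in `𝔅` is `p(B)`.**
[cite: HertlingLarabi2026b, §6 Thm. 6.2 (6.5) and proof, chunks p0012–p0013] -/
theorem toMatrix_mulLeft_aeval_eq {θ : A} {b : Basis (Fin n) ℚ A} {B : Matrix (Fin n) (Fin n) ℤ}
    (h : ∀ j, θ * b j = ∑ i, (B i j : ℚ) • b i) (p : ℚ[X]) :
    LinearMap.toMatrix b b (LinearMap.mulLeft ℚ (aeval θ p)) = aeval (B.map (Int.castRingHom ℚ)) p := by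
  rw [toMatrix_mulLeft_aeval, toMatrix_mulLeft_eq_map h]

/-- **A `ℚ`-linear map preserves the lattice `L = ⊕ ℤb_i` iff its matrix in `𝔅` is INTEGRAL** («It consists of
matrices in `M_{n×n}(ℤ)` if and only if `t̄L ⊂ L`», for an arbitrary endomorphism in place of `μ_t̄`).
[cite: HertlingLarabi2026b, §6 Thm. 6.2 (proof), chunk p0013] -/
theorem forall_mem_span_map_mem_iff (b : Basis (Fin n) ℚ A) (φ : A →ₗ[ℚ] A) :
    (∀ x ∈ span ℤ (Set.range b), φ x ∈ span ℤ (Set.range b)) ↔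
      ∃ C : Matrix (Fin n) (Fin n) ℤ, C.map (Int.castRingHom ℚ) = LinearMap.toMatrix b b φ := by
  constructor
  · intro h
    have hint : ∀ i j, ∃ z : ℤ, (z : ℚ) = LinearMap.toMatrix b b φ i j := fun i j => by
      obtain ⟨z, hz⟩ := (Basis.mem_span_iff_repr_mem ℤ b _).1 (h _ (subset_span ⟨j, rfl⟩)) i
      exact ⟨z, by rw [LinearMap.toMatrix_apply]; simpa using hz⟩
    choose C hC using hint
    exact ⟨Matrix.of fun i j => C i j, by ext i j; simp [hC]⟩
  · rintro ⟨C, hC⟩ x hx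
    refine Submodule.span_induction (p := fun x _ => φ x ∈ span ℤ (Set.range b)) ?_ ?_ ?_ ?_ hx
    · rintro _ ⟨j, rfl⟩
      have e : φ (b j) = ∑ i, (C i j : ℚ) • b i := by
        have h1 := Matrix.toLin_self b b (LinearMap.toMatrix b b φ) j
        rw [Matrix.toLin_toMatrix] at h1
        rw [h1]
        refine Finset.sum_congr rfl fun i _ => ?_
        rw [← hC, Matrix.map_apply, eq_intCast]
      rw [e]
      exact sum_mem fun i _ => by
        rw [Int.cast_smul_eq_zsmul]
        exact smul_mem _ _ (subset_span ⟨i, rfl⟩)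
    · rw [map_zero]
      exact zero_mem _
    · intro x y _ _ hx hy
      rw [map_add]
      exact add_mem hx hy
    · intro z x _ hx
      rw [map_zsmul]
      exact smul_mem _ _ hx

end Represents

/-- **THE ORDER OF A LATTICE IN MATRIX TERMS.** For a regular-matrix representation `θ𝔅 = 𝔅·B` of the lattice
`L = ⊕ ℤb_i ⊂ A_g` (`θ = t̄`): `p(t̄) ∈ 𝒪(L) = L:L ⟺ p(B) ∈ M_{n×n}(ℤ)`.  So «the order `Λ ⊃ Λ_f` with
`Λ = 𝒪(L)` and `[B]_ℤ ∼ [L]_ε`» is `{p(t̄) | p(B) integral}`.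
[cite: HertlingLarabi2026b, §6 Rem. 6.3 (v) («the order `Λ ⊃ Λ_f` with `Λ = 𝒪(L)` and `[B]_ℤ ∼ [L]_ε` is an interesting invariant of the `GL_n(ℤ)`-conjugacy class `[B]_ℤ`»), chunk p0013]
[cite: HertlingLarabi2026b, §6 Thm. 6.2 (proof), chunk p0013] -/
theorem mk_mem_div_self_iff {b : Basis (Fin n) ℚ (AdjoinRoot g)} {B : Matrix (Fin n) (Fin n) ℤ}
    (h : ∀ j, AdjoinRoot.root g * b j = ∑ i, (B i j : ℚ) • b i) (p : ℚ[X]) :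
    AdjoinRoot.mk g p ∈ span ℤ (Set.range b) / span ℤ (Set.range b) ↔
      ∃ C : Matrix (Fin n) (Fin n) ℤ, C.map (Int.castRingHom ℚ) = aeval (B.map (Int.castRingHom ℚ)) p := by
  rw [Submodule.mem_div_iff_forall_mul_mem, ← toMatrix_mulLeft_aeval_eq h p, ← forall_mem_span_map_mem_iff]
  have e : ∀ x, AdjoinRoot.mk g p * x = LinearMap.mulLeft ℚ (aeval (AdjoinRoot.root g) p) x := fun x => by
    rw [LinearMap.mulLeft_apply, AdjoinRoot.aeval_eq]
  simp_rw [e]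

/-! ## §3 The order of a conjugacy class: existence, uniqueness, conjugation invariance -/

/-- **Every regular integer matrix `B` with `p_B = g` HAS an order: there is a (unique, below) `Λ ⊂ A_g` with
`p(t̄) ∈ Λ ⟺ p(B) ∈ M_{n×n}(ℤ)`, namely `Λ = 𝒪(L)` for the lattice `L` of Theorem 6.2 (i); it is a full lattice and
an order containing `Λ_g = ℤ[t̄]`** («In any case, for `B` with `[B]_ℤ ∈ S_{1,f}` the order `Λ ⊃ Λ_f` with
`Λ = 𝒪(L)` and `[B]_ℤ ∼ [L]_ε` is an interesting invariant»).
[cite: HertlingLarabi2026b, §6 Rem. 6.3 (v), chunk p0013] -/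
theorem exists_order_of_minpoly_eq (hg : g.Monic) (hdeg : g.natDegree = n) {B : Matrix (Fin n) (Fin n) ℤ}
    (hB : minpoly ℚ (B.map (Int.castRingHom ℚ)) = g) :
    ∃ Λ : Submodule ℤ (AdjoinRoot g),
      (∀ p : ℚ[X], AdjoinRoot.mk g p ∈ Λ ↔
        ∃ C : Matrix (Fin n) (Fin n) ℤ, C.map (Int.castRingHom ℚ) = aeval (B.map (Int.castRingHom ℚ)) p) ∧
      IsFullLattice (AdjoinRoot g) Λ ∧ (1 : AdjoinRoot g) ∈ Λ ∧ Λ * Λ ≤ Λ ∧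
      Subalgebra.toSubmodule (Algebra.adjoin ℤ ({AdjoinRoot.root g} : Set (AdjoinRoot g))) ≤ Λ ∧
      ∃ L : Submodule ℤ (AdjoinRoot g), IsFullLattice (AdjoinRoot g) L ∧
        (∀ x ∈ L, AdjoinRoot.root g * x ∈ L) ∧ L / L = Λ ∧
        ∃ b : Basis (Fin n) ℚ (AdjoinRoot g), span ℤ (Set.range b) = L ∧
          ∀ j, AdjoinRoot.root g * b j = ∑ i, (B i j : ℚ) • b i := by
  obtain ⟨L, b, hL, hθ, hb, hrep⟩ := exists_isFullLattice_of_minpoly_eq hg hdeg hB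
  refine ⟨L / L, fun p => ?_, isFullLattice_div hL hL,
    Literature.NumberTheory.ComplexMultiplication.FiniteQAlgebraLattice.one_mem_div_self L,
    le_of_eq (Literature.NumberTheory.ComplexMultiplication.FiniteQAlgebraLattice.div_self_mul_div_self L),
    toSubmodule_adjoin_le_div_iff.2 hθ, L, hL, hθ, rfl, b, hb, hrep⟩
  rw [← hb]
  exact mk_mem_div_self_iff hrep p

/-- **The order of `B` is UNIQUE** (it is determined by the condition `p(t̄) ∈ Λ ⟺ p(B) ∈ M_{n×n}(ℤ)`, as every
element of `A_g` is a `p(t̄)`). [cite: HertlingLarabi2026b, §6 Rem. 6.3 (v), chunk p0013] -/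
theorem order_unique {B : Matrix (Fin n) (Fin n) ℤ} {Λ Λ' : Submodule ℤ (AdjoinRoot g)}
    (hΛ : ∀ p : ℚ[X], AdjoinRoot.mk g p ∈ Λ ↔
      ∃ C : Matrix (Fin n) (Fin n) ℤ, C.map (Int.castRingHom ℚ) = aeval (B.map (Int.castRingHom ℚ)) p)
    (hΛ' : ∀ p : ℚ[X], AdjoinRoot.mk g p ∈ Λ' ↔
      ∃ C : Matrix (Fin n) (Fin n) ℤ, C.map (Int.castRingHom ℚ) = aeval (B.map (Int.castRingHom ℚ)) p) :
    Λ = Λ' := by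
  ext a
  obtain ⟨p, rfl⟩ := AdjoinRoot.mk_surjective a
  rw [hΛ, hΛ']

/-- **The order is `𝒪(L)` for EVERY lattice `L` representing `B`** (any `ℤ`-basis `𝔅` of `L` with `t̄𝔅 = 𝔅·B`).
[cite: HertlingLarabi2026b, §6 Rem. 6.3 (v) with Thm. 6.2, chunk p0013] -/
theorem div_self_eq_of_represents {B : Matrix (Fin n) (Fin n) ℤ} {Λ : Submodule ℤ (AdjoinRoot g)}
    (hΛ : ∀ p : ℚ[X], AdjoinRoot.mk g p ∈ Λ ↔
      ∃ C : Matrix (Fin n) (Fin n) ℤ, C.map (Int.castRingHom ℚ) = aeval (B.map (Int.castRingHom ℚ)) p)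
    {L : Submodule ℤ (AdjoinRoot g)} {b : Basis (Fin n) ℚ (AdjoinRoot g)} (hb : span ℤ (Set.range b) = L)
    (hrep : ∀ j, AdjoinRoot.root g * b j = ∑ i, (B i j : ℚ) • b i) : L / L = Λ := by
  refine order_unique (fun p => ?_) hΛ
  rw [← hb]
  exact mk_mem_div_self_iff hrep p

/-- **The order is an invariant of the `GLₙ(ℤ)`-CONJUGACY CLASS: conjugate regular matrices have the same order**
(under Theorem 6.2 conjugate matrices give `ε`-equivalent lattices, and `𝒪(cL) = 𝒪(L)`, Lemma 5.5 ∕ HL 2026).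
[cite: HertlingLarabi2026b, §6 Rem. 6.3 (v) («an interesting invariant of the `GL_n(ℤ)`-conjugacy class `[B]_ℤ`»), chunk p0013] -/
theorem order_eq_of_conj (hg : g.Monic) (hdeg : g.natDegree = n) {B B' : Matrix (Fin n) (Fin n) ℤ}
    (hB : minpoly ℚ (B.map (Int.castRingHom ℚ)) = g) (hB' : minpoly ℚ (B'.map (Int.castRingHom ℚ)) = g)
    {P : Matrix (Fin n) (Fin n) ℤ} (hP : IsUnit P.det) (hPB : P * B = B' * P)
    {Λ Λ' : Submodule ℤ (AdjoinRoot g)}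
    (hΛ : ∀ p : ℚ[X], AdjoinRoot.mk g p ∈ Λ ↔
      ∃ C : Matrix (Fin n) (Fin n) ℤ, C.map (Int.castRingHom ℚ) = aeval (B.map (Int.castRingHom ℚ)) p)
    (hΛ' : ∀ p : ℚ[X], AdjoinRoot.mk g p ∈ Λ' ↔
      ∃ C : Matrix (Fin n) (Fin n) ℤ, C.map (Int.castRingHom ℚ) = aeval (B'.map (Int.castRingHom ℚ)) p) :
    Λ = Λ' := by
  obtain ⟨Φ, hΦ⟩ := exists_equiv_quot_conj_quot_units_smul hg hdeg
  obtain ⟨L, b, hL, hθ, hb, hrep⟩ := exists_isFullLattice_of_minpoly_eq hg hdeg hB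
  obtain ⟨L', b', hL', hθ', hb', hrep'⟩ := exists_isFullLattice_of_minpoly_eq hg hdeg hB'
  have h1 := hΦ ⟨B, hB⟩ ⟨L, hL, hθ⟩ b hb hrep
  have h2 := hΦ ⟨B', hB'⟩ ⟨L', hL', hθ'⟩ b' hb' hrep'
  have h3 : Quot.mk (fun B₁ B₂ : {B : Matrix (Fin n) (Fin n) ℤ // minpoly ℚ (B.map (Int.castRingHom ℚ)) = g} =>
      ∃ P : Matrix (Fin n) (Fin n) ℤ, IsUnit P.det ∧ P * B₁.1 = B₂.1 * P) ⟨B, hB⟩ = Quot.mk _ ⟨B', hB'⟩ :=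
    Quot.sound ⟨P, hP, hPB⟩
  rw [h3, h2] at h1
  obtain ⟨c, hc⟩ := (equivalence_exists_units_smul _).eqvGen_iff.1 (Quot.eqvGen_exact h1.symm)
  have hc' : c • L = L' := hc
  -- `cL = L'`, so `𝒪(L') = 𝒪(L)`
  rw [← div_self_eq_of_represents hΛ hb hrep, ← div_self_eq_of_represents hΛ' hb' hrep', ← hc',
    div_self_units_smul]

/-! ## §4 REMARKS 6.3 (v): each stratum `{[B]_ℤ | order = Λ}` of `S_{1,f}` is FINITE (Theorem 6.5) -/

/-- **REMARKS 6.3 (v) — the strata are finite.** «In any case, the set `S_{1,f}` splits into the disjoint union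
`⊔̇_{Λ ⊃ Λ_f order} {[L]_ε | L ∈ 𝓛(A_f), 𝒪(L) = Λ}` of sets which are finite by Theorem 5.3.»  Matrix form: for
every `Λ`, the `GLₙ(ℤ)`-conjugacy classes of regular integer matrices `B` with `p_B = g` WHOSE ORDER IS `Λ`
(`p(t̄) ∈ Λ ⟺ p(B) ∈ M_{n×n}(ℤ)`) form a FINITE set — `[B]_ℤ ↦ [L]_ε` (Thm. 6.2) maps them injectively into
`{[L]_ε | 𝒪(L) = Λ}`, finite by HL 2026 Thm. 6.5 (`FiniteQAlgebraLattice.finite_quot_div_self_eq`) applied to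
`A_g = ℚ[t]/(g)`, ANY monic `g` (multiple roots allowed). [cite: HertlingLarabi2026b, §6 Rem. 6.3 (v), chunk p0013]
[cite: HertlingLarabi2026, §6 Thm. 6.5, chunk p0015] -/
theorem finite_quot_conj_of_order (hg : g.Monic) (hdeg : g.natDegree = n) (Λ : Submodule ℤ (AdjoinRoot g)) :
    Finite (Quot fun B B' : {B : Matrix (Fin n) (Fin n) ℤ // minpoly ℚ (B.map (Int.castRingHom ℚ)) = g ∧
        ∀ p : ℚ[X], AdjoinRoot.mk g p ∈ Λ ↔ ∃ C : Matrix (Fin n) (Fin n) ℤ,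
          C.map (Int.castRingHom ℚ) = aeval (B.map (Int.castRingHom ℚ)) p} =>
      ∃ P : Matrix (Fin n) (Fin n) ℤ, IsUnit P.det ∧ P * B.1 = B'.1 * P) := by
  haveI : Module.Finite ℚ (AdjoinRoot g) := (AdjoinRoot.powerBasis hg.ne_zero).finite
  by_cases hne : Nonempty {B : Matrix (Fin n) (Fin n) ℤ // minpoly ℚ (B.map (Int.castRingHom ℚ)) = g ∧
      ∀ p : ℚ[X], AdjoinRoot.mk g p ∈ Λ ↔ ∃ C : Matrix (Fin n) (Fin n) ℤ,
        C.map (Int.castRingHom ℚ) = aeval (B.map (Int.castRingHom ℚ)) p}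
  swap
  · haveI := not_nonempty_iff.1 hne
    infer_instance
  obtain ⟨B₀⟩ := hne
  obtain ⟨Φ, hΦ⟩ := exists_equiv_quot_conj_quot_units_smul hg hdeg
  -- the lattice of each `B` in the stratum (Thm. 6.2 (i)), with `𝒪(L_B) = Λ`
  have hex : ∀ B : {B : Matrix (Fin n) (Fin n) ℤ // minpoly ℚ (B.map (Int.castRingHom ℚ)) = g ∧
      ∀ p : ℚ[X], AdjoinRoot.mk g p ∈ Λ ↔ ∃ C : Matrix (Fin n) (Fin n) ℤ,
        C.map (Int.castRingHom ℚ) = aeval (B.map (Int.castRingHom ℚ)) p},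
      ∃ (L : Submodule ℤ (AdjoinRoot g)) (b : Basis (Fin n) ℚ (AdjoinRoot g)),
        IsFullLattice (AdjoinRoot g) L ∧ (∀ x ∈ L, AdjoinRoot.root g * x ∈ L) ∧ span ℤ (Set.range b) = L ∧
        ∀ j, AdjoinRoot.root g * b j = ∑ i, (B.1 i j : ℚ) • b i := fun B =>
    exists_isFullLattice_of_minpoly_eq hg hdeg B.2.1
  choose Lat bas hLat hθ hbas hrep using hex
  have hO : ∀ B, Lat B / Lat B = Λ := fun B => div_self_eq_of_represents B.2.2 (hbas B) (hrep B)
  have hΛ : IsFullLattice (AdjoinRoot g) Λ := hO B₀ ▸ isFullLattice_div (hLat B₀) (hLat B₀)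
  haveI := finite_quot_div_self_eq hΛ
  have hΦB : ∀ B : {B : Matrix (Fin n) (Fin n) ℤ // minpoly ℚ (B.map (Int.castRingHom ℚ)) = g ∧
      ∀ p : ℚ[X], AdjoinRoot.mk g p ∈ Λ ↔ ∃ C : Matrix (Fin n) (Fin n) ℤ,
        C.map (Int.castRingHom ℚ) = aeval (B.map (Int.castRingHom ℚ)) p},
      Φ (Quot.mk _ ⟨B.1, B.2.1⟩) = Quot.mk _ ⟨Lat B, hLat B, hθ B⟩ := fun B =>
    hΦ ⟨B.1, B.2.1⟩ ⟨Lat B, hLat B, hθ B⟩ (bas B) (hbas B) (hrep B)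
  -- `[B]_ℤ ↦ [L_B]_ε ∈ {[L]_ε | 𝒪(L) = Λ}`
  let F : Quot (fun B B' : {B : Matrix (Fin n) (Fin n) ℤ // minpoly ℚ (B.map (Int.castRingHom ℚ)) = g ∧
        ∀ p : ℚ[X], AdjoinRoot.mk g p ∈ Λ ↔ ∃ C : Matrix (Fin n) (Fin n) ℤ,
          C.map (Int.castRingHom ℚ) = aeval (B.map (Int.castRingHom ℚ)) p} =>
        ∃ P : Matrix (Fin n) (Fin n) ℤ, IsUnit P.det ∧ P * B.1 = B'.1 * P) →
      Quot fun L L' : {L : Submodule ℤ (AdjoinRoot g) // IsFullLattice (AdjoinRoot g) L ∧ L / L = Λ} =>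
        ∃ u : (AdjoinRoot g)ˣ, u • L.1 = L'.1 :=
    Quot.lift (fun B => Quot.mk _ ⟨Lat B, hLat B, hO B⟩) (by
      rintro B B' ⟨P, hP, hPB⟩
      have h1 : Quot.mk (fun B₁ B₂ : {B : Matrix (Fin n) (Fin n) ℤ //
          minpoly ℚ (B.map (Int.castRingHom ℚ)) = g} =>
          ∃ P : Matrix (Fin n) (Fin n) ℤ, IsUnit P.det ∧ P * B₁.1 = B₂.1 * P) ⟨B.1, B.2.1⟩ =
          Quot.mk _ ⟨B'.1, B'.2.1⟩ := Quot.sound ⟨P, hP, hPB⟩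
      have h2 := congrArg Φ h1
      rw [hΦB, hΦB] at h2
      obtain ⟨c, hc⟩ := (equivalence_exists_units_smul _).eqvGen_iff.1 (Quot.eqvGen_exact h2)
      exact Quot.sound ⟨c, hc⟩)
  refine Finite.of_injective F ?_
  rintro ⟨B⟩ ⟨B'⟩ h
  obtain ⟨c, hc⟩ := (equivalence_exists_units_smul _).eqvGen_iff.1 (Quot.eqvGen_exact h)
  have h2 : Quot.mk (fun L L' : {L : Submodule ℤ (AdjoinRoot g) //
      IsFullLattice (AdjoinRoot g) L ∧ ∀ x ∈ L, AdjoinRoot.root g * x ∈ L} =>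
      ∃ c : (AdjoinRoot g)ˣ, c • L.1 = L'.1) ⟨Lat B, hLat B, hθ B⟩ = Quot.mk _ ⟨Lat B', hLat B', hθ B'⟩ :=
    Quot.sound ⟨c, hc⟩
  rw [← hΦB, ← hΦB] at h2
  obtain ⟨P, hP, hPB⟩ := (equivalence_conj _).eqvGen_iff.1 (Quot.eqvGen_exact (Φ.injective h2))
  exact Quot.sound ⟨P, hP, hPB⟩

/-- **REMARKS 6.3 (v) — `S_{1,f}` is the union of the strata**: every class `[B]_ℤ ∈ S_{1,f}` lies in the stratum of
its order `Λ ⊇ Λ_f` («the set `S_{1,f}` splits into the disjoint union» over the orders `Λ ⊃ Λ_f`; disjointness is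
`order_unique`). [cite: HertlingLarabi2026b, §6 Rem. 6.3 (v), chunk p0013] -/
theorem exists_order_and_mem_stratum (hg : g.Monic) (hdeg : g.natDegree = n) {B : Matrix (Fin n) (Fin n) ℤ}
    (hB : minpoly ℚ (B.map (Int.castRingHom ℚ)) = g) :
    ∃ Λ : Submodule ℤ (AdjoinRoot g), IsFullLattice (AdjoinRoot g) Λ ∧ (1 : AdjoinRoot g) ∈ Λ ∧ Λ * Λ ≤ Λ ∧
      Subalgebra.toSubmodule (Algebra.adjoin ℤ ({AdjoinRoot.root g} : Set (AdjoinRoot g))) ≤ Λ ∧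
      ∀ p : ℚ[X], AdjoinRoot.mk g p ∈ Λ ↔
        ∃ C : Matrix (Fin n) (Fin n) ℤ, C.map (Int.castRingHom ℚ) = aeval (B.map (Int.castRingHom ℚ)) p := by
  obtain ⟨Λ, hΛ, hfull, h1, hmul, hadj, -⟩ := exists_order_of_minpoly_eq hg hdeg hB
  exact ⟨Λ, hfull, h1, hmul, hadj, hΛ⟩

/-! ## §5 REMARKS 6.3 (v): «a union of infinitely many finite sets» iff `f` has a multiple root -/

/-- **REMARKS 6.3 (v), the number of strata**: for `f ∈ ℤ[t]` monic of degree `n`, the set of orders `Λ` that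
OCCUR as the order of a regular integer matrix with characteristic polynomial `f` is FINITE iff `f` has no
multiple root (square-free over `ℚ`) — «If the conditions in (iv) do not hold, it is a union of infinitely many
finite sets» (and if they hold `S_{1,f}` itself is finite, Rem. 6.3 (iv)). Proof: the strata are finite
(`finite_quot_conj_of_order`) and cover `S_{1,f}`, which is finite iff `f` is square-free
(`LatimerMacDuffeeSquarefree.finite_quot_conj_iff_squarefree`). [cite: HertlingLarabi2026b, §6 Rem. 6.3 (iv)–(v), chunk p0013] -/
theorem finite_setOf_order_iff_squarefree {f : ℤ[X]} (hf : f.Monic) (hdeg : f.natDegree = n) :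
    {Λ : Submodule ℤ (AdjoinRoot (f.map (Int.castRingHom ℚ))) | ∃ B : Matrix (Fin n) (Fin n) ℤ,
        minpoly ℚ (B.map (Int.castRingHom ℚ)) = f.map (Int.castRingHom ℚ) ∧
        ∀ p : ℚ[X], AdjoinRoot.mk (f.map (Int.castRingHom ℚ)) p ∈ Λ ↔ ∃ C : Matrix (Fin n) (Fin n) ℤ,
          C.map (Int.castRingHom ℚ) = aeval (B.map (Int.castRingHom ℚ)) p}.Finite ↔
      Squarefree (f.map (Int.castRingHom ℚ)) := by
  have hg : (f.map (Int.castRingHom ℚ)).Monic := hf.map _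
  have hdeg' : (f.map (Int.castRingHom ℚ)).natDegree = n := by
    rw [Polynomial.natDegree_map_eq_of_injective (Int.castRingHom ℚ).injective_int, hdeg]
  set g := f.map (Int.castRingHom ℚ)
  -- the order of each regular `B`
  have hex : ∀ B : {B : Matrix (Fin n) (Fin n) ℤ // minpoly ℚ (B.map (Int.castRingHom ℚ)) = g},
      ∃ Λ : Submodule ℤ (AdjoinRoot g), ∀ p : ℚ[X], AdjoinRoot.mk g p ∈ Λ ↔
        ∃ C : Matrix (Fin n) (Fin n) ℤ, C.map (Int.castRingHom ℚ) = aeval (B.1.map (Int.castRingHom ℚ)) p :=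
    fun B => by
      obtain ⟨Λ, hΛ, -⟩ := exists_order_of_minpoly_eq hg hdeg' B.2
      exact ⟨Λ, hΛ⟩
  choose ord hord using hex
  have hrange : {Λ : Submodule ℤ (AdjoinRoot g) | ∃ B : Matrix (Fin n) (Fin n) ℤ,
      minpoly ℚ (B.map (Int.castRingHom ℚ)) = g ∧
      ∀ p : ℚ[X], AdjoinRoot.mk g p ∈ Λ ↔ ∃ C : Matrix (Fin n) (Fin n) ℤ,
        C.map (Int.castRingHom ℚ) = aeval (B.map (Int.castRingHom ℚ)) p} = Set.range ord := by
    ext Λ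
    constructor
    · rintro ⟨B, hB, hΛ⟩
      exact ⟨⟨B, hB⟩, order_unique (hord ⟨B, hB⟩) hΛ⟩
    · rintro ⟨B, rfl⟩
      exact ⟨B.1, B.2, hord B⟩
  rw [hrange, ← finite_quot_conj_iff_squarefree hf hdeg]
  -- `ord` is constant on conjugacy classes
  have hordc : ∀ B B' : {B : Matrix (Fin n) (Fin n) ℤ // minpoly ℚ (B.map (Int.castRingHom ℚ)) = g},
      (∃ P : Matrix (Fin n) (Fin n) ℤ, IsUnit P.det ∧ P * B.1 = B'.1 * P) → ord B = ord B' :=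
    fun B B' ⟨P, hP, hPB⟩ => order_eq_of_conj hg hdeg' B.2 B'.2 hP hPB (hord B) (hord B')
  constructor
  · -- finitely many orders, each stratum finite ⟹ `S_{1,f}` finite
    intro hfin
    haveI : Finite (Set.range ord) := hfin.to_subtype
    haveI : ∀ Λ : Set.range ord, Finite (Quot fun B B' : {B : Matrix (Fin n) (Fin n) ℤ //
        minpoly ℚ (B.map (Int.castRingHom ℚ)) = g ∧
        ∀ p : ℚ[X], AdjoinRoot.mk g p ∈ (Λ : Submodule ℤ (AdjoinRoot g)) ↔ ∃ C : Matrix (Fin n) (Fin n) ℤ,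
          C.map (Int.castRingHom ℚ) = aeval (B.map (Int.castRingHom ℚ)) p} =>
        ∃ P : Matrix (Fin n) (Fin n) ℤ, IsUnit P.det ∧ P * B.1 = B'.1 * P) :=
      fun Λ => finite_quot_conj_of_order hg hdeg' Λ.1
    let G : (Σ Λ : Set.range ord, Quot fun B B' : {B : Matrix (Fin n) (Fin n) ℤ //
        minpoly ℚ (B.map (Int.castRingHom ℚ)) = g ∧
        ∀ p : ℚ[X], AdjoinRoot.mk g p ∈ (Λ : Submodule ℤ (AdjoinRoot g)) ↔ ∃ C : Matrix (Fin n) (Fin n) ℤ,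
          C.map (Int.castRingHom ℚ) = aeval (B.map (Int.castRingHom ℚ)) p} =>
        ∃ P : Matrix (Fin n) (Fin n) ℤ, IsUnit P.det ∧ P * B.1 = B'.1 * P) →
        Quot fun B B' : {B : Matrix (Fin n) (Fin n) ℤ // minpoly ℚ (B.map (Int.castRingHom ℚ)) = g} =>
          ∃ P : Matrix (Fin n) (Fin n) ℤ, IsUnit P.det ∧ P * B.1 = B'.1 * P :=
      fun x => x.2.map
        (fun B : {B : Matrix (Fin n) (Fin n) ℤ // minpoly ℚ (B.map (Int.castRingHom ℚ)) = g ∧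
            ∀ p : ℚ[X], AdjoinRoot.mk g p ∈ (x.1 : Submodule ℤ (AdjoinRoot g)) ↔ ∃ C : Matrix (Fin n) (Fin n) ℤ,
              C.map (Int.castRingHom ℚ) = aeval (B.map (Int.castRingHom ℚ)) p} =>
          (⟨B.1, B.2.1⟩ : {B : Matrix (Fin n) (Fin n) ℤ // minpoly ℚ (B.map (Int.castRingHom ℚ)) = g}))
        fun B B' h => h
    refine Finite.of_surjective G ?_
    rintro ⟨B⟩
    let x : {B' : Matrix (Fin n) (Fin n) ℤ // minpoly ℚ (B'.map (Int.castRingHom ℚ)) = g ∧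
        ∀ p : ℚ[X], AdjoinRoot.mk g p ∈ ((⟨ord B, B, rfl⟩ : Set.range ord) : Submodule ℤ (AdjoinRoot g)) ↔
          ∃ C : Matrix (Fin n) (Fin n) ℤ, C.map (Int.castRingHom ℚ) = aeval (B'.map (Int.castRingHom ℚ)) p} :=
      ⟨B.1, B.2, hord B⟩
    exact ⟨⟨⟨ord B, B, rfl⟩, Quot.mk _ x⟩, rfl⟩
  · -- `S_{1,f}` finite ⟹ finitely many orders (`ord` factors through the classes)
    intro hfin
    let ordq : Quot (fun B B' : {B : Matrix (Fin n) (Fin n) ℤ // minpoly ℚ (B.map (Int.castRingHom ℚ)) = g} =>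
        ∃ P : Matrix (Fin n) (Fin n) ℤ, IsUnit P.det ∧ P * B.1 = B'.1 * P) → Submodule ℤ (AdjoinRoot g) :=
      Quot.lift ord hordc
    have hr : Set.range ord = Set.range ordq := by
      ext Λ
      constructor
      · rintro ⟨B, rfl⟩
        exact ⟨Quot.mk _ B, rfl⟩
      · rintro ⟨q, rfl⟩
        induction q using Quot.ind with
        | _ B => exact ⟨B, rfl⟩
    rw [hr]
    exact Set.finite_range ordq

/-- **REMARKS 6.3 (v) for `f` WITH A MULTIPLE ROOT: infinitely many orders occur, each with a finite stratum**
(«If the conditions in (iv) do not hold, it is a union of infinitely many finite sets»).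
[cite: HertlingLarabi2026b, §6 Rem. 6.3 (v), chunk p0013] -/
theorem infinite_setOf_order_of_not_squarefree {f : ℤ[X]} (hf : f.Monic) (hdeg : f.natDegree = n)
    (hnsq : ¬Squarefree (f.map (Int.castRingHom ℚ))) :
    {Λ : Submodule ℤ (AdjoinRoot (f.map (Int.castRingHom ℚ))) | ∃ B : Matrix (Fin n) (Fin n) ℤ,
        minpoly ℚ (B.map (Int.castRingHom ℚ)) = f.map (Int.castRingHom ℚ) ∧
        ∀ p : ℚ[X], AdjoinRoot.mk (f.map (Int.castRingHom ℚ)) p ∈ Λ ↔ ∃ C : Matrix (Fin n) (Fin n) ℤ,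
          C.map (Int.castRingHom ℚ) = aeval (B.map (Int.castRingHom ℚ)) p}.Infinite :=
  fun h => hnsq ((finite_setOf_order_iff_squarefree hf hdeg).1 h)

/-! ## §6 REMARKS 6.3 (iii)+(v): the order of the companion matrix is `Λ_f = ℤ[t̄]` -/

/-- **The order of the class `[M_f]_ℤ` of the COMPANION MATRIX is `Λ_f = ℤ[t̄]` itself**: `p(t̄) ∈ ℤ[t̄] ⟺ p(M_f) ∈
M_{n×n}(ℤ)` («The unit element `[Λ_f]` in `S_{2,f}` corresponds to the `GL_n(ℤ)`-conjugacy class `[M_f]_ℤ` in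
`S_{1,f}`», and `𝒪(Λ_f) = Λ_f`). [cite: HertlingLarabi2026b, §6 Rem. 6.3 (iii), (v), chunk p0013] -/
theorem mk_mem_adjoin_iff_companion {f : ℤ[X]} (hf : f.Monic) (hdeg : f.natDegree = n) (p : ℚ[X]) :
    AdjoinRoot.mk (f.map (Int.castRingHom ℚ)) p ∈
        Subalgebra.toSubmodule (Algebra.adjoin ℤ
          ({AdjoinRoot.root (f.map (Int.castRingHom ℚ))} : Set (AdjoinRoot (f.map (Int.castRingHom ℚ))))) ↔
      ∃ C : Matrix (Fin n) (Fin n) ℤ, C.map (Int.castRingHom ℚ) =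
        aeval (((Literature.LinearAlgebra.Matrix.companion (fun i : Fin n => f.coeff i) :
          Matrix (Fin n) (Fin n) ℤ)).map (Int.castRingHom ℚ)) p := by
  have hg : (f.map (Int.castRingHom ℚ)).Monic := hf.map _
  have hdeg' : (f.map (Int.castRingHom ℚ)).natDegree = n := by
    rw [Polynomial.natDegree_map_eq_of_injective (Int.castRingHom ℚ).injective_int, hdeg]
  obtain ⟨b, hb, hrep, -⟩ := exists_basis_pow_companion hf hdeg
  rw [← mk_mem_div_self_iff hrep p]
  -- `𝒪(L) = ℤ[t̄]` for `L = ⊕ ℤ t̄^i`: `t̄L ⊆ L` gives `⊇`; `1 ∈ L ⊆ ℤ[t̄]` gives `⊆`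
  set θ := AdjoinRoot.root (f.map (Int.castRingHom ℚ))
  have hθ : ∀ x ∈ span ℤ (Set.range b), θ * x ∈ span ℤ (Set.range b) :=
    fun x hx => mul_mem_span_of_forall_mul_eq_sum hrep hx
  have hLsub : span ℤ (Set.range b) ≤ Subalgebra.toSubmodule (Algebra.adjoin ℤ ({θ} : Set _)) := by
    refine span_le.2 ?_
    rintro _ ⟨i, rfl⟩
    rw [hb i]
    exact Subalgebra.pow_mem _ (Algebra.self_mem_adjoin_singleton ℤ θ) _
  suffices hO : span ℤ (Set.range b) / span ℤ (Set.range b) =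
      Subalgebra.toSubmodule (Algebra.adjoin ℤ ({θ} : Set _)) by rw [hO]
  refine le_antisymm (fun a ha => ?_) (toSubmodule_adjoin_le_div_iff.2 hθ)
  rcases Nat.eq_zero_or_pos n with hn | hn
  · -- `n = 0`: `A_f = 0`
    subst hn
    haveI : Module.Finite ℚ (AdjoinRoot (f.map (Int.castRingHom ℚ))) := (AdjoinRoot.powerBasis hg.ne_zero).finite
    haveI : Subsingleton (AdjoinRoot (f.map (Int.castRingHom ℚ))) :=
      Module.finrank_zero_iff.1 (finrank_adjoinRoot hg hdeg')
    rw [Subsingleton.elim a 0]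
    exact zero_mem _
  · have h1 : (1 : AdjoinRoot (f.map (Int.castRingHom ℚ))) ∈ span ℤ (Set.range b) := by
      have h : b ⟨0, hn⟩ ∈ span ℤ (Set.range b) := subset_span ⟨⟨0, hn⟩, rfl⟩
      rwa [hb, show ((⟨0, hn⟩ : Fin n) : ℕ) = 0 from rfl, pow_zero] at h
    exact hLsub (by simpa using (Submodule.mem_div_iff_forall_mul_mem.1 ha) 1 h1)

end Literature.LinearAlgebra.Matrix.LatimerMacDuffeeOrderStrata
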